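import Mathlib
import Literature.AlgebraicGeometry.Resolution.BlowupPrincipalCharts
import Literature.AlgebraicGeometry.Resolution.BlowupLiftsCongruence
import Literature.AlgebraicGeometry.Resolution.AffineBlowupAlgebra
import Summits.ResolutionOfSingularities.ResolutionOfSingularities.Theorems.WildQuotientsWildQuotientResolutionToricExitChartA
import Summits.ResolutionOfSingularities.ResolutionOfSingularities.Theorems.WildQuotientsWildQuotientResolutionToricExitRootChartEven

/-!
# V3U cone brick, chart half: the sections of `V` over the principal chart `V[x_a]` are the even subalgebra

(crux stmt-ResolutionOfSingularities-15640 `WildQuotients.WildQuotientResolution`, line `Sketch`,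
sector `|G| = p`; programme V3U of `L/w45c/CHAIN.md` v6.2 §4.0 row stub-3 «HPa THE CONE BRICK» of
`ToricExit.jordanThree_hasResolution_of_bricks` (p496627). [OURS · L1 W4.5c] — NOT a statement of
any manuscript; replaces the role of no printed item. Prover res-L1-w45c-stub-3.)

* `exists_blowupAlgebra_ringEquiv_of_ringEquiv` — transport of the affine blowup algebra `R[J/a]`
  along a ring isomorphism `θ : R ≃ R'` (to `R'[θJ/θa]`), compatibly with the structure maps.
* `appLE_appLE_of_comp_eq` — sections bookkeeping: for `α ≫ π = π ≫ β`, pulling back `π^*s` along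
  `α` is pulling back `β^*s` along `π`.
* `specAction_appTop_ΓSpecIso_inv_smul` — for the affine-quotient law `ρ g = Spec (g⁻¹)`,
  `(ρ g)^* x = g⁻¹ • x` on global sections.
* `exists_ringEquiv_blowupChart_adjoin` — **`Γ(V, V[x_a]) ≅ k[ρ², ρβ, β², …]`** for
  `V = Bl_{(x_a, x_b²)} 𝔸ⁿ` and its INTRINSIC principal chart `V[x_a] = blowupChart π Ĩ₂ ⊤ x_a`
  (Literature `BlowupPrincipalCharts`), carrying `π^* f` to the root substitution `ψ₀ f`
  (`x_a ↦ ρ²`, `x_b ↦ ρβ`): the chain `Γ(V, V[x_a]) ≅ Γ(𝔸ⁿ,⊤)[Ĩ₂(⊤)/x_a]`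
  (`IsBlowup.exists_ringEquiv_blowupChart`) `≅ k[x][(x_a, x_b²)/x_a]` (transport along `ΓSpecIso`)
  `≅ (k[x][It])_{(x_a t)}` (`reesChartEquiv`) `≅ k[ρ², ρβ, β², …]` (stub-2's D3
  `ToricExit.chartA_ringEquiv_adjoin`, p486657).
-/

-- single-problem summit: the doubled namespace component `ResolutionOfSingularities` is forced
set_option linter.dupNamespace false

noncomputable section

universe u

open CategoryTheory AlgebraicGeometry TopologicalSpace MvPolynomial IsLocalization
open Literature.AlgebraicGeometry.Resolution

namespace Summit.ResolutionOfSingularities.ResolutionOfSingularities.Theorems.WildQuotientResolution.ToricExit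

/-! ## Transport of the affine blowup algebra along a ring isomorphism -/

/-- **`R[J/a] ≅ R'[θ(J)/θ(a)]` along a ring isomorphism `θ : R ≃ R'`**, compatibly with the
structure maps (the induced isomorphism of localisations `R[1/a] ≅ R'[1/θ a]` maps the generators
`x/a` to `θ(x)/θ(a)`). [folklore] -/
theorem exists_blowupAlgebra_ringEquiv_of_ringEquiv {R R' : Type u} [CommRing R] [CommRing R']
    (θ : R ≃+* R') (J : Ideal R) (a : R) (J' : Ideal R') (hJ' : J' = J.map (θ : R →+* R'))
    (a' : R') (ha' : a' = θ a) :
    ∃ e : blowupAlgebra J a ≃+* blowupAlgebra J' a',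
      ∀ r : R, e (algebraMap R (blowupAlgebra J a) r) = algebraMap R' (blowupAlgebra J' a') (θ r) := by
  subst hJ' ha'
  let L := Localization.Away a
  let L' := Localization.Away (θ a)
  have H : (Submonoid.powers a).map θ.toMonoidHom = Submonoid.powers (θ a) :=
    Submonoid.map_powers θ.toMonoidHom a
  let Λ : L ≃+* L' := IsLocalization.ringEquivOfRingEquiv L L' θ H
  have hΛ : ∀ r : R, Λ (algebraMap R L r) = algebraMap R' L' (θ r) := fun r =>
    IsLocalization.ringEquivOfRingEquiv_eq H r
  have hΛsymm : ∀ r' : R', Λ.symm (algebraMap R' L' r') = algebraMap R L (θ.symm r') := by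
    intro r'
    apply Λ.injective
    rw [RingEquiv.apply_symm_apply, hΛ, RingEquiv.apply_symm_apply]
  have hΛinv : Λ (Away.invSelf a) = Away.invSelf (θ a) := by
    have h1 : Λ (Away.invSelf a) * algebraMap R' L' (θ a) = 1 := by
      rw [← hΛ, ← map_mul, mul_comm, Away.mul_invSelf, map_one]
    have h2 : Away.invSelf (θ a) * algebraMap R' L' (θ a) = 1 := by
      rw [mul_comm, Away.mul_invSelf]
    exact (IsLocalization.Away.algebraMap_isUnit (S := L') (θ a)).mul_left_injective (h1.trans h2.symm)
  have hΛinv' : Λ.symm (Away.invSelf (θ a)) = Away.invSelf a := by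
    rw [← hΛinv, RingEquiv.symm_apply_apply]
  -- `Λ` maps `R[J/a]` into `R'[θJ/θa]`
  have hfwd : ∀ y ∈ blowupAlgebra J a, Λ y ∈ blowupAlgebra (J.map (θ : R →+* R')) (θ a) := by
    intro y hy
    induction hy using Algebra.adjoin_induction with
    | mem x hx =>
      obtain ⟨z, hz, rfl⟩ := hx
      rw [map_mul, hΛ, hΛinv]
      exact div_mem_blowupAlgebra _ _ (Ideal.mem_map_of_mem _ hz)
    | algebraMap r =>
      rw [hΛ]
      exact Subalgebra.algebraMap_mem _ _
    | add x y _ _ hx hy => rw [map_add]; exact Subalgebra.add_mem _ hx hy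
    | mul x y _ _ hx hy => rw [map_mul]; exact Subalgebra.mul_mem _ hx hy
  -- `Λ⁻¹` maps back
  have hbwd : ∀ y ∈ blowupAlgebra (J.map (θ : R →+* R')) (θ a), Λ.symm y ∈ blowupAlgebra J a := by
    intro y hy
    induction hy using Algebra.adjoin_induction with
    | mem x hx =>
      obtain ⟨z, hz, rfl⟩ := hx
      rw [map_mul, hΛsymm, hΛinv']
      refine div_mem_blowupAlgebra _ _ ?_
      rw [Ideal.map_comap_of_equiv, Ideal.mem_comap] at hz
      exact hz
    | algebraMap r =>
      rw [hΛsymm]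
      exact Subalgebra.algebraMap_mem _ _
    | add x y _ _ hx hy => rw [map_add]; exact Subalgebra.add_mem _ hx hy
    | mul x y _ _ hx hy => rw [map_mul]; exact Subalgebra.mul_mem _ hx hy
  let e : blowupAlgebra J a ≃+* blowupAlgebra (J.map (θ : R →+* R')) (θ a) :=
    { toFun := fun y => ⟨Λ y, hfwd y y.2⟩
      invFun := fun z => ⟨Λ.symm z, hbwd z z.2⟩
      left_inv := fun y => Subtype.ext (Λ.symm_apply_apply _)
      right_inv := fun z => Subtype.ext (Λ.apply_symm_apply _)
      map_mul' := fun y₁ y₂ => Subtype.ext (by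
        change Λ ((y₁ * y₂ : blowupAlgebra J a) : L) = Λ (y₁ : L) * Λ (y₂ : L)
        rw [Subalgebra.coe_mul, map_mul])
      map_add' := fun y₁ y₂ => Subtype.ext (by
        change Λ ((y₁ + y₂ : blowupAlgebra J a) : L) = Λ (y₁ : L) + Λ (y₂ : L)
        rw [Subalgebra.coe_add, map_add]) }
  refine ⟨e, fun r => Subtype.ext ?_⟩
  change Λ (algebraMap R L r) = algebraMap R' L' (θ r)
  exact hΛ r

/-! ## Sections bookkeeping for equivariant morphisms over an affine base -/

/-- **Pull-backs along an equivariant pair**: if `α ≫ π = π ≫ β` and `U ≤ α⁻¹U`, then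
`α^*(π^* s)|_U = π^*(β^* s)|_U` for global sections `s` of the base. [folklore] -/
theorem appLE_appLE_of_comp_eq {X' Y : Scheme.{u}} (π : X' ⟶ Y) (α : X' ⟶ X') (β : Y ⟶ Y)
    (h : α ≫ π = π ≫ β) (U : X'.Opens) (hU : U ≤ α ⁻¹ᵁ U) (hle : U ≤ π ⁻¹ᵁ ⊤) (s : Γ(Y, ⊤)) :
    α.appLE U U hU (π.appLE ⊤ U hle s) = π.appLE ⊤ U hle (β.appTop s) := by
  have e1 : U ≤ (α ≫ π) ⁻¹ᵁ ⊤ := le_top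
  have h1 : α.appLE U U hU (π.appLE ⊤ U hle s) = (α ≫ π).appLE ⊤ U e1 s := by
    rw [← CommRingCat.comp_apply, Scheme.Hom.appLE_comp_appLE]
  have h2 : (α ≫ π).appLE ⊤ U e1 s = (π ≫ β).appLE ⊤ U (h ▸ e1) s := by
    rw [appLE_congr_hom h]
  have h3 : (π ≫ β).appLE ⊤ U (h ▸ e1) s = π.appLE ⊤ U hle (β.appLE ⊤ ⊤ le_top s) := by
    rw [← CommRingCat.comp_apply, Scheme.Hom.appLE_comp_appLE]
  have h4 : β.appLE ⊤ ⊤ le_top = β.appTop := by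
    rw [Scheme.Hom.appTop, Scheme.Hom.app_eq_appLE]
    rfl
  rw [h1, h2, h3, h4]

/-- **The affine-quotient law on global sections**: for `ρ g = Spec (g⁻¹)` on `Spec B`,
`(ρ g)^* x = g⁻¹ • x` through `ΓSpecIso`. [folklore] -/
theorem specAction_appTop_ΓSpecIso_inv_smul {B : Type u} [CommRing B] {G : Type*} [Group G]
    [MulSemiringAction G B] (ρ : G →* Aut (Spec (CommRingCat.of B)))
    (hρ : ∀ g : G, (ρ g).hom = Spec.map (CommRingCat.ofHom
      ((MulSemiringAction.toRingEquiv G B g⁻¹ : B ≃+* B) : B →+* B)))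
    (x : B) (g : G) :
    (ρ g).hom.appTop ((Scheme.ΓSpecIso (CommRingCat.of B)).inv x) =
      (Scheme.ΓSpecIso (CommRingCat.of B)).inv (g⁻¹ • x) := by
  rw [hρ g]
  have h := Scheme.ΓSpecIso_inv_naturality (CommRingCat.ofHom
    ((MulSemiringAction.toRingEquiv G B g⁻¹ : B ≃+* B) : B →+* B))
  have h' := congrArg (fun φ => φ x) (congrArg (fun φ : CommRingCat.of B ⟶ _ => ⇑φ.hom) h)
  simp only [CommRingCat.hom_comp, RingHom.coe_comp, Function.comp_apply,
    CommRingCat.hom_ofHom] at h'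
  rw [← h']
  rfl

/-! ## `Γ(V, V[x_a])` is the even subalgebra -/

/-- **`Γ(V, V[x_a]) ≅ k[ρ², ρβ, β², …]` with `π^* ↦ ψ₀`** for `V = Bl_{(x_a, x_b²)} 𝔸ⁿ` and its
intrinsic principal chart at `x_a` (the chain in the module docstring). [OURS · L1 W4.5c] [folklore] -/
theorem exists_ringEquiv_blowupChart_adjoin (k : Type) [Field k] (n : ℕ) (a b : Fin n)
    (hab : a ≠ b) :
    ∃ Θ : Γ(affineBlowup (Ideal.span (Set.range (![X a, X b ^ 2] : Fin 2 → MvPolynomial (Fin n) k))),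
        blowupChart
          (affineBlowup.π (Ideal.span (Set.range (![X a, X b ^ 2] :
            Fin 2 → MvPolynomial (Fin n) k))))
          (affineBlowup.idealSheaf (Ideal.span (Set.range (![X a, X b ^ 2] :
            Fin 2 → MvPolynomial (Fin n) k))))
          ⟨⊤, isAffineOpen_top _⟩
          ((Scheme.ΓSpecIso (CommRingCat.of (MvPolynomial (Fin n) k))).inv.hom (X a))) ≃+*
        ↥(Algebra.adjoin k (chartAGens k n a b)),
      ∀ f : MvPolynomial (Fin n) k,
        ((Θ ((affineBlowup.π (Ideal.span (Set.range (![X a, X b ^ 2] :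
            Fin 2 → MvPolynomial (Fin n) k)))).appLE ⊤
          (blowupChart
            (affineBlowup.π (Ideal.span (Set.range (![X a, X b ^ 2] :
              Fin 2 → MvPolynomial (Fin n) k))))
            (affineBlowup.idealSheaf (Ideal.span (Set.range (![X a, X b ^ 2] :
              Fin 2 → MvPolynomial (Fin n) k))))
            ⟨⊤, isAffineOpen_top _⟩
            ((Scheme.ΓSpecIso (CommRingCat.of (MvPolynomial (Fin n) k))).inv.hom (X a)))
          (blowupChart_le_preimage _ _ _ _)
          ((Scheme.ΓSpecIso (CommRingCat.of (MvPolynomial (Fin n) k))).inv.hom f)) :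
            ↥(Algebra.adjoin k (chartAGens k n a b))) : MvPolynomial (Fin n) k) =
          MvPolynomial.aeval (fun i => if i = a then X a ^ 2 else if i = b then X a * X b else
            (X i : MvPolynomial (Fin n) k)) f := by
  classical
  let S : Type := MvPolynomial (Fin n) k
  let c : Fin 2 → S := ![X a, X b ^ 2]
  let I₂ : Ideal S := Ideal.span (Set.range c)
  have hπ : IsBlowup (affineBlowup.π I₂) (affineBlowup.idealSheaf I₂) := affineBlowup.isBlowup I₂
  let ι₀ : S →+* Γ(Spec (CommRingCat.of S), ⊤) := (Scheme.ΓSpecIso (CommRingCat.of S)).inv.hom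
  let θ : Γ(Spec (CommRingCat.of S), ⊤) ≃+* S :=
    (Scheme.ΓSpecIso (CommRingCat.of S)).commRingCatIsoToRingEquiv
  have hθ : ∀ f : S, θ (ι₀ f) = f := fun f => by
    change ((Scheme.ΓSpecIso (CommRingCat.of S)).inv ≫ (Scheme.ΓSpecIso (CommRingCat.of S)).hom) f = f
    rw [Iso.inv_hom_id]; rfl
  have hIdeal : (affineBlowup.idealSheaf I₂).ideal ⟨⊤, isAffineOpen_top _⟩ = I₂.map ι₀ := by
    change (Scheme.IdealSheafData.ofIdealTop _).ideal ⟨⊤, isAffineOpen_top _⟩ = _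
    rw [ideal_ofIdealTop_top]
  have hxa : ι₀ (X a) ∈ (affineBlowup.idealSheaf I₂).ideal ⟨⊤, isAffineOpen_top _⟩ := by
    rw [hIdeal]; exact Ideal.mem_map_of_mem _ (Ideal.subset_span ⟨0, rfl⟩)
  -- (1) `Γ(V, V[x_a]) ≅ Γ(𝔸ⁿ, ⊤)[Ĩ₂(⊤) / x_a]`
  obtain ⟨e₁, he₁⟩ := hπ.exists_ringEquiv_blowupChart ⟨⊤, isAffineOpen_top _⟩ hxa
  -- (2) transport along `Γ(𝔸ⁿ, ⊤) ≅ k[x]`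
  have hJ' : I₂ = ((affineBlowup.idealSheaf I₂).ideal ⟨⊤, isAffineOpen_top _⟩).map
      (θ : Γ(Spec (CommRingCat.of S), ⊤) →+* S) := by
    rw [hIdeal, Ideal.map_map]
    have hcomp : (θ : Γ(Spec (CommRingCat.of S), ⊤) →+* S).comp ι₀ = RingHom.id S :=
      RingHom.ext fun f => hθ f
    rw [hcomp, Ideal.map_id]
  have ha' : (X a : S) = θ (ι₀ (X a)) := (hθ (X a)).symm
  obtain ⟨e₂, he₂⟩ := exists_blowupAlgebra_ringEquiv_of_ringEquiv θ
    ((affineBlowup.idealSheaf I₂).ideal ⟨⊤, isAffineOpen_top _⟩) (ι₀ (X a)) I₂ hJ' (X a) ha'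
  -- (3) `k[x][I₂/x_a] ≅ (k[x][It])_{(x_a t)}` and (4) D3
  let e₃ : blowupAlgebra I₂ (X a) ≃+* chartRing c 0 :=
    (reesChartEquiv (c 0) (Ideal.mem_span_range_self (f := c) (x := 0))).symm
  have he₃ : ∀ f : S, e₃ (algebraMap S (blowupAlgebra I₂ (X a)) f) = chartBase c 0 f := by
    intro f
    apply (reesChartEquiv (c 0) (Ideal.mem_span_range_self (f := c) (x := 0))).injective
    change (reesChartEquiv (c 0) _) ((reesChartEquiv (c 0) _).symm _) = _
    rw [RingEquiv.apply_symm_apply, reesChartEquiv_reesChartBase]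
    rfl
  obtain ⟨e₄, he₄, -⟩ := chartA_ringEquiv_adjoin k n a b hab
  refine ⟨e₁.trans (e₂.trans (e₃.trans e₄)), fun f => ?_⟩
  change ((e₄ (e₃ (e₂ (e₁ _))) : ↥(Algebra.adjoin k (chartAGens k n a b))) : S) = _
  rw [he₁, he₂, hθ, he₃]
  exact he₄ f

end Summit.ResolutionOfSingularities.ResolutionOfSingularities.Theorems.WildQuotientResolution.ToricExit

end
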